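import Summits.ABC.ABC.Theorems.PlatonicClosureCorePowerLift
import HarnessLib

/-!
# PlatonicClosureCoreFloorBlocker — part 5/6 of the ROUTE-INDEPENDENT node kernel `PlatonicClosureCore` (door J, second layer; lens-1 gen 7)

Source: lens-1 g7 ROUTE-INDEPENDENT landing variant `pkg/PlatonicClosureTheorems.lean` (cell `decomp-abc`; sha256
`f8bb28f6c96ac600…`; = node file `PlatonicClosure.lean` v2.2 with the three `Theses.RootDecompJ/B/G` imports replaced
by seven inline TREE TEXTS §T, writer recipe decomp-abc STATUS l.502; lens `lean check` rc 0 · 0 sorry · axioms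
standard; critic PRE-CLEARED l.513, bridge test `Iff.rfl` ×7 against J rev 3 / B rev 7 / G rev 6 rc 0).

This module: §11 FLOOR BLOCKER: «two members `N`-full» in any two positions carries the summit — `abc_iff_fullAC'`,
`abc_iff_fullBC'`, `abc_iff_fullAB'` (odd power-sum lift `sumpow_transport`), `floor_blocker`, `dichotomy_localises`,
`fullAC_pow_image`.

Landing form: MECHANICAL six-module split of the source (full account in part 1/6 `PlatonicClosureCoreTransport`): namespace
`Summit.ABC.ABC.Theorems.PlatonicClosureCore`, docstrings, imports, `private` copies of landed folklore lemmas; statements and proofs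
byte-identical; imports NO route file (route `closes` may cite it by defeq of the §T tree texts).  Proves neither `ABC` nor any item.
-/

set_option linter.dupNamespace false
-- lint debt, justified: verbatim planner-cleared proofs keep the item texts' binder names (some hypotheses are unused by name).
set_option linter.unusedVariables false

open Literature.NumberTheory.DiophantineGeometry
open UniqueFactorizationMonoid
open Finset

namespace Summit.ABC.ABC.Theorems.PlatonicClosureCore

/-! Private verbatim copies (gate `dedup.landed`: these folklore statements are already landed in the tree, e.g. in the
J-importing chain `Theorems/PlatonicClosure*.lean`; `private` in their home module here) — so that every proof below
stays byte-identical to the source. -/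

/-- The members of an abc triple are nonzero and `a < c`, `b < c`. -/
private theorem triple_facts {a b c : ℕ} (ht : IsABCTriple a b c) :
    a ≠ 0 ∧ b ≠ 0 ∧ c ≠ 0 ∧ a < c ∧ b < c := by
  obtain ⟨ha, hb, habc, _⟩ := ht
  omega

/-- `radical (m * n) ≤ radical m * radical n`. -/
private theorem radical_mul_le (m n : ℕ) : radical (m * n) ≤ radical m * radical n :=
  Nat.le_of_dvd (Nat.mul_pos (Nat.radical_pos _) (Nat.radical_pos _)) radical_mul_dvd

/-- `radical n ≤ n` for `0 < n`. -/
private theorem radical_le_self {n : ℕ} (hn : 0 < n) : radical n ≤ n := Nat.le_of_dvd hn radical_dvd_self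

/-- `radical (m * n) ≤ radical m * n` for `0 < n`. -/
private theorem radical_mul_le_mul_self (m : ℕ) {n : ℕ} (hn : 0 < n) : radical (m * n) ≤ radical m * n :=
  (radical_mul_le m n).trans (Nat.mul_le_mul_left _ (radical_le_self hn))

/-- For a coprime triple, `rad(abc) = rad a · rad b · rad c`. -/
private theorem rad_eq_prod {a b c : ℕ} (ht : IsABCTriple a b c) : rad a b c = radical a * radical b * radical c := by
  obtain ⟨ha, hb, habc, hcop⟩ := ht
  have hac : Nat.Coprime a c := by rw [← habc]; exact Nat.coprime_self_add_right.mpr hcop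
  have hbc : Nat.Coprime b c := by rw [← habc]; exact Nat.coprime_add_self_right.mpr hcop.symm
  rw [rad_def, radical_mul (Nat.coprime_iff_isRelPrime.mp (Nat.Coprime.mul_left hac hbc)),
    radical_mul (Nat.coprime_iff_isRelPrime.mp hcop)]

/-- `c^(k+1) - a^(k+1) ≤ (k+1) · c^k · (c - a)` for `0 ≤ a ≤ c` in `ℤ`. -/
private theorem pow_sub_pow_le (a c : ℤ) (ha : 0 ≤ a) (hac : a ≤ c) (k : ℕ) :
    c ^ (k + 1) - a ^ (k + 1) ≤ ((k : ℤ) + 1) * c ^ k * (c - a) := by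
  induction k with
  | zero => simp
  | succ n ih =>
    have hc : 0 ≤ c := ha.trans hac
    have e : c ^ (n + 1 + 1) - a ^ (n + 1 + 1) = c * (c ^ (n + 1) - a ^ (n + 1)) + a ^ (n + 1) * (c - a) := by
      ring
    rw [e]
    have h1 : c * (c ^ (n + 1) - a ^ (n + 1)) ≤ c * (((n : ℤ) + 1) * c ^ n * (c - a)) :=
      mul_le_mul_of_nonneg_left ih hc
    have h2 : a ^ (n + 1) * (c - a) ≤ c ^ (n + 1) * (c - a) :=
      mul_le_mul_of_nonneg_right (pow_le_pow_left₀ ha hac _) (by linarith)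
    calc _ ≤ c * (((n : ℤ) + 1) * c ^ n * (c - a)) + c ^ (n + 1) * (c - a) := add_le_add h1 h2
      _ = (((n + 1 : ℕ) : ℤ) + 1) * c ^ (n + 1) * (c - a) := by push_cast; ring

/-- THE POWER LIFT (degree `k+1`): image profile `≥ (k+1, 1, k+1)`, `c^{k+1} = c'`, `rad' ≤ (k+1)·rad·cᵏ`. -/
private theorem pow_transport (k : ℕ) {a b c : ℕ} (ht : IsABCTriple a b c) :
    ∃ a' b' c' : ℕ, IsABCTriple a' b' c' ∧ (Adm (k + 1) a' ∧ Adm (k + 1) c') ∧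
      c ^ (k + 1) ≤ 1 * c' ∧ rad a' b' c' ≤ (k + 1) * rad a b c * c ^ k := by
  obtain ⟨ha0, hb0, hc0, hac, hbc⟩ := triple_facts ht
  obtain ⟨ha, hb, habc, hcop⟩ := ht
  have hN0 : k + 1 ≠ 0 := by omega
  have hlt : a ^ (k + 1) < c ^ (k + 1) := Nat.pow_lt_pow_left hac hN0
  have hcopac : Nat.Coprime a c := by rw [← habc]; exact Nat.coprime_self_add_right.mpr hcop
  refine ⟨a ^ (k + 1), c ^ (k + 1) - a ^ (k + 1), c ^ (k + 1),
    ⟨by positivity, Nat.sub_pos_of_lt hlt, Nat.add_sub_of_le hlt.le, ?_⟩,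
    ⟨adm_pow hN0 ha0, adm_pow hN0 hc0⟩, by rw [one_mul], ?_⟩
  · -- coprime
    apply Nat.Coprime.pow_left
    have h1 : Nat.Coprime a (c ^ (k + 1)) := hcopac.pow_right (k + 1)
    have e : c ^ (k + 1) - a ^ (k + 1) + a ^ k * a = c ^ (k + 1) := by
      rw [← pow_succ]; exact Nat.sub_add_cancel hlt.le
    rw [← e] at h1
    exact (Nat.coprime_add_mul_right_right _ _ _).mp h1
  · -- radical bound
    have hdvd : b ∣ c ^ (k + 1) - a ^ (k + 1) := by
      have := Nat.sub_dvd_pow_sub_pow c a (k + 1)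
      rwa [show c - a = b by omega] at this
    obtain ⟨G, hG⟩ := hdvd
    have hG0 : 0 < G := by
      rcases Nat.eq_zero_or_pos G with h | h
      · rw [h, mul_zero] at hG; exact absurd hG (Nat.sub_pos_of_lt hlt).ne'
      · exact h
    have hGle : G ≤ (k + 1) * c ^ k := by
      have h1 : ((c : ℤ) ^ (k + 1) - a ^ (k + 1)) ≤ ((k : ℤ) + 1) * c ^ k * (c - a) :=
        pow_sub_pow_le a c (by positivity) (by exact_mod_cast hac.le) k
      have h2 : ((c ^ (k + 1) - a ^ (k + 1) : ℕ) : ℤ) = (b : ℤ) * G := by exact_mod_cast hG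
      rw [Nat.cast_sub hlt.le] at h2
      push_cast at h2
      rw [h2, show ((c : ℤ) - a) = b by rw [← habc]; push_cast; ring] at h1
      have h3 : (b : ℤ) * G ≤ (b : ℤ) * (((k : ℤ) + 1) * c ^ k) := by linarith
      have h4 : (G : ℤ) ≤ ((k : ℤ) + 1) * c ^ k := le_of_mul_le_mul_left h3 (by exact_mod_cast hb)
      exact_mod_cast h4
    calc rad (a ^ (k + 1)) (c ^ (k + 1) - a ^ (k + 1)) (c ^ (k + 1))
        = radical (a ^ (k + 1) * (c ^ (k + 1) - a ^ (k + 1)) * c ^ (k + 1)) := rad_def _ _ _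
      _ ≤ radical (a ^ (k + 1)) * radical (c ^ (k + 1) - a ^ (k + 1)) * radical (c ^ (k + 1)) :=
          (radical_mul_le _ _).trans (Nat.mul_le_mul_right _ (radical_mul_le _ _))
      _ = radical a * radical (b * G) * radical c := by rw [radical_pow _ hN0, radical_pow _ hN0, hG]
      _ ≤ radical a * (radical b * G) * radical c :=
          Nat.mul_le_mul_right _ (Nat.mul_le_mul_left _ (radical_mul_le_mul_self _ hG0))
      _ = rad a b c * G := by rw [rad_eq_prod ⟨ha, hb, habc, hcop⟩]; ring
      _ ≤ rad a b c * ((k + 1) * c ^ k) := Nat.mul_le_mul_left _ hGle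
      _ = (k + 1) * rad a b c * c ^ k := by ring

/-- abc triples are symmetric in `a, b`. -/
private theorem isABCTriple_swap {a b c : ℕ} (ht : IsABCTriple a b c) : IsABCTriple b a c := by
  obtain ⟨ha, hb, habc, hcop⟩ := ht
  exact ⟨hb, ha, by omega, hcop.symm⟩

/-- The radical `rad a b c` is symmetric in `a, b`. -/
private theorem rad_swap (a b c : ℕ) : rad b a c = rad a b c := by
  rw [rad_def, rad_def, mul_comm b a]

/-! ## §11  FLOOR BLOCKER (cycle 2, identity side): «two members `N`-full», in ANY two positions and WITHOUT the thin
pieces, already carries the summit — for every `N ≥ 1`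

Positions `{a,c}` / `{b,c}`: the power lift `(aᴺ, cᴺ − aᴺ, cᴺ)` of §7 and its mirror.  Positions `{a,b}` (the two SMALL
members): the odd power-sum lift `(aᴹ, bᴹ, aᴹ + bᴹ)`, `M` odd, whose third rational special point is `t = −1`
(`a + b ∣ aᴹ + bᴹ`), so again exactly one power of `c` is lost: `rad' ≤ rad·c^{M−1}`, `cᴹ ≤ 2ᴹ·c'`.
Consequently ANY cell containing one of `FullAC N`, `FullBC N`, `FullAB N` (some `N ≥ 1`) is `≡ S` (`floor_blocker`), and
every door's dichotomy `Q / ¬Q` localises onto such a thin carrier (`dichotomy_localises`): in the blocker grammar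
«residual ⊇ R», `R` may be taken thin (population `≍ B^{2/N}`).  NOT loaded by any of these: cells cut by valuation
CEILINGS or residues (`N₅`, `c ≤ K·N₅⁴`, smoothness) — identities certify valuations only from below. -/

/-- members `a` and `c` are `N`-full -/
def FullAC (N : ℕ) (a _b c : ℕ) : Prop := Adm N a ∧ Adm N c
/-- members `b` and `c` are `N`-full -/
def FullBC (N : ℕ) (_a b c : ℕ) : Prop := Adm N b ∧ Adm N c
/-- members `a` and `b` (the two small ones) are `N`-full -/
def FullAB (N : ℕ) (a b _c : ℕ) : Prop := Adm N a ∧ Adm N b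

/-- Floor blocker, positions `{a, c}`: `ABC ↔` abc on the triples with `a` and `c` both `(k+1)`-full. -/
theorem abc_iff_fullAC (k : ℕ) : _root_.ABC ↔ AbcOn (FullAC (k + 1)) := by
  refine ⟨fun h => abcOn_of_abc h _, fun hQ => ?_⟩
  refine abc_of_transport hQ (k := k) (A := 1) (K := k + 1) one_pos (Nat.succ_pos k) fun a b c ht => ?_
  obtain ⟨a', b', c', ht', ⟨hA, hC⟩, hc', hr'⟩ := pow_transport k ht
  exact ⟨a', b', c', ht', ⟨hA, hC⟩, hc', hr'⟩

/-- Floor blocker, positions `{b, c}`: `ABC ↔` abc on the triples with `b` and `c` both `(k+1)`-full. -/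
theorem abc_iff_fullBC (k : ℕ) : _root_.ABC ↔ AbcOn (FullBC (k + 1)) := by
  refine ⟨fun h => abcOn_of_abc h _, fun hQ => ?_⟩
  refine abc_of_transport hQ (k := k) (A := 1) (K := k + 1) one_pos (Nat.succ_pos k) fun a b c ht => ?_
  obtain ⟨a', b', c', ht', ⟨hA, hC⟩, hc', hr'⟩ := pow_transport k ht
  exact ⟨b', a', c', isABCTriple_swap ht', ⟨hA, hC⟩, hc', by rwa [rad_swap]⟩

/-- THE ODD POWER-SUM LIFT (degree `M = 2m+1`): `(a,b,c) ↦ (aᴹ, bᴹ, aᴹ + bᴹ)`; `cᴹ ≤ 2ᴹ·c'`, `rad' ≤ rad·c^{2m}`. -/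
theorem sumpow_transport (m : ℕ) {a b c : ℕ} (ht : IsABCTriple a b c) :
    ∃ a' b' c' : ℕ, IsABCTriple a' b' c' ∧ (Adm (2 * m + 1) a' ∧ Adm (2 * m + 1) b') ∧
      c ^ (2 * m + 1) ≤ 2 ^ (2 * m + 1) * c' ∧ rad a' b' c' ≤ 1 * rad a b c * c ^ (2 * m) := by
  obtain ⟨ha0, hb0, hc0, hac, hbc⟩ := triple_facts ht
  obtain ⟨ha, hb, habc, hcop⟩ := ht
  have hM0 : 2 * m + 1 ≠ 0 := by omega
  have hModd : Odd (2 * m + 1) := ⟨m, rfl⟩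
  have hdvd : c ∣ a ^ (2 * m + 1) + b ^ (2 * m + 1) := by
    rw [← habc]; exact Odd.nat_add_dvd_pow_add_pow a b hModd
  obtain ⟨Φ, hΦ⟩ := hdvd
  have hc'pos : 0 < a ^ (2 * m + 1) + b ^ (2 * m + 1) := by positivity
  have hΦ0 : 0 < Φ := by
    rcases Nat.eq_zero_or_pos Φ with h | h
    · rw [h, mul_zero] at hΦ; omega
    · exact h
  have hcpos : 0 < c := by omega
  -- a^M + b^M ≤ c^M, hence Φ ≤ c^{2m}
  have hle : a ^ (2 * m + 1) + b ^ (2 * m + 1) ≤ c ^ (2 * m + 1) := by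
    rw [← habc]; exact pow_add_pow_le ha.le hb.le hM0
  have hΦle : Φ ≤ c ^ (2 * m) := by
    have h1 : c * Φ ≤ c * c ^ (2 * m) := by rw [← hΦ, ← pow_succ']; exact hle
    exact Nat.le_of_mul_le_mul_left h1 hcpos
  -- c^M ≤ 2^M (a^M + b^M)
  have hgain : c ^ (2 * m + 1) ≤ 2 ^ (2 * m + 1) * (a ^ (2 * m + 1) + b ^ (2 * m + 1)) := by
    rcases le_total a b with hab | hab
    · have hc2 : c ≤ 2 * b := by omega
      calc c ^ (2 * m + 1) ≤ (2 * b) ^ (2 * m + 1) := Nat.pow_le_pow_left hc2 _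
        _ = 2 ^ (2 * m + 1) * b ^ (2 * m + 1) := mul_pow _ _ _
        _ ≤ 2 ^ (2 * m + 1) * (a ^ (2 * m + 1) + b ^ (2 * m + 1)) := Nat.mul_le_mul_left _ (Nat.le_add_left _ _)
    · have hc2 : c ≤ 2 * a := by omega
      calc c ^ (2 * m + 1) ≤ (2 * a) ^ (2 * m + 1) := Nat.pow_le_pow_left hc2 _
        _ = 2 ^ (2 * m + 1) * a ^ (2 * m + 1) := mul_pow _ _ _
        _ ≤ 2 ^ (2 * m + 1) * (a ^ (2 * m + 1) + b ^ (2 * m + 1)) := Nat.mul_le_mul_left _ (Nat.le_add_right _ _)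
  refine ⟨a ^ (2 * m + 1), b ^ (2 * m + 1), a ^ (2 * m + 1) + b ^ (2 * m + 1),
    ⟨by positivity, by positivity, rfl, Nat.Coprime.pow _ _ hcop⟩,
    ⟨adm_pow hM0 ha0, adm_pow hM0 hb0⟩, hgain, ?_⟩
  -- radical bound
  calc rad (a ^ (2 * m + 1)) (b ^ (2 * m + 1)) (a ^ (2 * m + 1) + b ^ (2 * m + 1))
      = radical (a ^ (2 * m + 1) * b ^ (2 * m + 1) * (c * Φ)) := by rw [rad_def, hΦ]
    _ ≤ radical (a ^ (2 * m + 1)) * radical (b ^ (2 * m + 1)) * radical (c * Φ) :=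
        (radical_mul_le _ _).trans (Nat.mul_le_mul_right _ (radical_mul_le _ _))
    _ = radical a * radical b * radical (c * Φ) := by rw [radical_pow _ hM0, radical_pow _ hM0]
    _ ≤ radical a * radical b * (radical c * Φ) := Nat.mul_le_mul_left _ (radical_mul_le_mul_self _ hΦ0)
    _ = rad a b c * Φ := by rw [rad_eq_prod ⟨ha, hb, habc, hcop⟩]; ring
    _ ≤ rad a b c * c ^ (2 * m) := Nat.mul_le_mul_left _ hΦle
    _ = 1 * rad a b c * c ^ (2 * m) := by ring

/-- Floor blocker, positions `{a, b}`, odd level: `ABC ↔` abc on the triples with `a` and `b` both `(2m+1)`-full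
(odd power-sum lift). -/
theorem abc_iff_fullAB_odd (m : ℕ) : _root_.ABC ↔ AbcOn (FullAB (2 * m + 1)) := by
  refine ⟨fun h => abcOn_of_abc h _, fun hQ => ?_⟩
  refine abc_of_transport hQ (k := 2 * m) (A := 2 ^ (2 * m + 1)) (K := 1) (by positivity) one_pos
    fun a b c ht => ?_
  obtain ⟨a', b', c', ht', hAB, hc', hr'⟩ := sumpow_transport m ht
  exact ⟨a', b', c', ht', hAB, hc', hr'⟩

/-- every `N ≥ 1`, positions `{a,c}` -/
theorem abc_iff_fullAC' {N : ℕ} (hN : N ≠ 0) : _root_.ABC ↔ AbcOn (FullAC N) := by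
  obtain ⟨k, rfl⟩ := Nat.exists_eq_succ_of_ne_zero hN; exact abc_iff_fullAC k
/-- every `N ≥ 1`, positions `{b,c}` -/
theorem abc_iff_fullBC' {N : ℕ} (hN : N ≠ 0) : _root_.ABC ↔ AbcOn (FullBC N) := by
  obtain ⟨k, rfl⟩ := Nat.exists_eq_succ_of_ne_zero hN; exact abc_iff_fullBC k
/-- every `N ≥ 1`, positions `{a,b}` (reduce to the odd exponent `2N+1 ≥ N`) -/
theorem abc_iff_fullAB' {N : ℕ} (hN : N ≠ 0) : _root_.ABC ↔ AbcOn (FullAB N) := by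
  refine ⟨fun h => abcOn_of_abc h _, fun hQ => (abc_iff_fullAB_odd N).mpr ?_⟩
  exact abcOn_mono (fun a b c h => ⟨adm_mono h.1 hN (by omega), adm_mono h.2 hN (by omega)⟩) hQ

/-- **FLOOR BLOCKER.**  Any cell `Q` containing, for some `N ≥ 1`, one of the three «two members `N`-full» cells carries the
summit: `abc|Q ⟺ ABC`.  (Every root split of abc whose residual contains such a cell leaves a residual `≡ S`.) -/
theorem floor_blocker {Q : ℕ → ℕ → ℕ → Prop} {N : ℕ} (hN : N ≠ 0)
    (h : (∀ a b c, FullAC N a b c → Q a b c) ∨ (∀ a b c, FullBC N a b c → Q a b c) ∨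
      (∀ a b c, FullAB N a b c → Q a b c)) :
    AbcOn Q ↔ _root_.ABC := by
  refine ⟨fun hQ => ?_, fun hS => abcOn_of_abc hS _⟩
  rcases h with h | h | h
  · exact (abc_iff_fullAC' hN).mpr (abcOn_mono h hQ)
  · exact (abc_iff_fullBC' hN).mpr (abcOn_mono h hQ)
  · exact (abc_iff_fullAB' hN).mpr (abcOn_mono h hQ)

/-- **LOCALISATION of any dichotomy.**  For every predicate `Q` (a door's cell / residual cut) and every `N ≥ 1`:
`ABC ⟺ abc|(FullAC N ∩ Q) ∧ abc|(FullAC N ∩ ¬Q)` — a door's residual species is already carried by its trace on the thin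
carrier «`a`, `c` both `N`-full» (population `≍ B^{2/N}`). -/
theorem dichotomy_localises (Q : ℕ → ℕ → ℕ → Prop) {N : ℕ} (hN : N ≠ 0) :
    _root_.ABC ↔ AbcOn (fun a b c => FullAC N a b c ∧ Q a b c) ∧ AbcOn (fun a b c => FullAC N a b c ∧ ¬ Q a b c) := by
  refine ⟨fun h => ⟨abcOn_of_abc h _, abcOn_of_abc h _⟩, fun h => (abc_iff_fullAC' hN).mpr ?_⟩
  refine abcOn_mono (fun a b c hF => ?_) (abcOn_or h.1 h.2)
  by_cases hq : Q a b c
  · exact Or.inl ⟨hF, hq⟩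
  · exact Or.inr ⟨hF, hq⟩

/-- the three thin carriers are populated for every `N` (e.g. `(1, 2ᴺ − 1, 2ᴺ)`-type members are NOT in them, but
`(aᴺ, cᴺ − aᴺ, cᴺ)` images are): the image of `1 + 1 = 2` under the power lift, `(1, 2ᴺ − 1, 2ᴺ)`, lies in `FullAC N`. -/
theorem fullAC_pow_image (k : ℕ) : FullAC (k + 1) 1 (2 ^ (k + 1) - 1) (2 ^ (k + 1)) :=
  ⟨adm_one _, adm_pow (by omega) (by omega)⟩

end Summit.ABC.ABC.Theorems.PlatonicClosureCore
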